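import Summits.BirchSwinnertonDyer.Rank1Residual.AdditivePotMult.PotMultRankOneKatoCertificate
import Summits.BirchSwinnertonDyer.Rank1Residual.Additive.CensusQ6UnitCoeffCertificate
import Summits.BirchSwinnertonDyer.Rank1Residual.Additive.CongruentPartnerMainConjecture
import HarnessLib

/-!
# X4(M) ∩ {`ρ̄_{E,p}` onto}, EVERY odd `p` (`p = 3` included): Kato's divisibility on the
# `ω^{(p−1)/2}`-branch of the MULTIPLICATIVE twist `E♭` + the census record "first `p`-adic unit
# coefficient at index `n₀`" ⟹ `μ(X(E/ℚ_∞)) = 0 ∧ λ ≤ n₀`, and the MAIN CONJECTURE at the pair from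
# n1011-p10's budget input or on MINIMAL rows (cell `b2b-bsdres`, team n1011, seat p07 (gen 3), row
# T-E3dM = T-E3d F3: the (M) twin of n1011-p10's "Route G" `CongruentPartnerMainConjecture.lean`)

HONEST FRAMING (cell `b2b-bsdres`, run/shared/lean/b2b/bsd-rank1-residual/, verbatim in every
file): the goal of the cell is to DELETE the COMBINATION-SHAPED residual classes of the
Birch–Swinnerton-Dyer formula for ALL analytic-rank `≤ 1` elliptic curves over `ℚ` — "full BSD
formula for every rank `≤ 1` curve in class `C`" assembled STRICTLY from published theorems — so
that the rank-`≤ 1` remainder becomes exactly the CONSTRUCTION-SHAPED classes, which are TYPED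
(missing-input `Prop`s), NOT attempted. This is not "finishing BSD". Team n1011 (RESIDUAL-MAP §I
N10 / N11 LOWER half and O7 on the (M) rows = X4(M) ∧ surj(p), every odd `p`): research route on
CONSTRUCTION-SHAPED items; labels and marks UNCHANGED; nothing booked; NO Literature fact minted;
NO definition (the certificate currencies of record are census-ctyper1's records
`CensusQ6.Mult[Odd]FirstUnitIndexAt` and n1011-p06's binders `Mult[Odd]BranchUnitCoeffCert`; the
`λ`-currency is n1011-p01's `CharLamLeAt`; the LOWER input is n1011-p10's `BudgetLeLambdaAt`). Named
facts enter as HYPOTHESES only: `hK` = the semistable big-image half-eigenspace reading of Kato 2004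
Thm. 17.4 (3) (`Wuthrich2014.kato_halfEigenCharIdeal_dvd_cyclotomicPrime_of_surjective`), `hmodD` =
modular parametrisation data. A census record is CERTIFICATE-EVIDENCE (two engines), never a fact;
the budget input is a typed per-curve input discharged outside the kernel (EPW 2006 §3). Debt 0.

## What and why

T-O7KM (`PotMultRankOneKatoCertificate.lean`) read Kato's FULL-SERIES identity `ι g = C(u·ϖ)·B`
(`g ∈ char_Λ X(E/ℚ_∞)`, `u ∈ ℤ_p^×`, `B = L_p^{±}(f_{E♭}, a_p = ±1, ω^{(p−1)/2}, T)`) at `T¹` with the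
one-number certificate (`n₀ = 1`, rank one). The SAME brick read at an arbitrary index `n₀` with
census-ctyper1's record `Mult[Odd]FirstUnitIndexAt W p n₀` ("`‖[T^{n₀}](ϖ·B)‖_p = 1`") gives
`HasUnitContent g ∧ λ(g) ≤ n₀` (n1011-p10's K-G `hasUnitContent_and_lam_le_of_iota_eq_of_norm_coeff_eq_one`),
hence, for every generator `fE` of `char_Λ X(E/ℚ_∞)`, `μ(fE) = 0` and `λ(fE) ≤ n₀ = λ_an`: the
`(μ, ≤λ)` HALF of the main conjecture at the pair — inputs (a) + (b) of Route G on the (M) rows.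
Route G's typed LOWER input (c) then SQUEEZES it to the main conjecture at the pair: the budget
`BudgetLeLambdaAt p W n₀` (`budgetSqueeze`, partner-free; `n₀ = B(E,p)` the `p`-Tamagawa budget) —
or nothing at all on MINIMAL rows `n₀ = rank E(ℚ)` (`Iwasawa.minimal_package`, iw-1).

* §1 (data level, ANY semistable twist datum, index `n`; reduction-agnostic)
  `isTorsion_and_exists_iota_eq_unitContent_of_katoHalf`: tower + `hK` + `‖[Tⁿ](ϖ·B)‖ = 1` ⟹
  `X` torsion and SOME `g ∈ char_Λ X` with `ι g = C(u·ϖ)·B`, unit content, `λ(g) ≤ n`; with the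
  budget (`charIdeal_eq_span_of_katoHalf_of_norm_coeff_of_budget`) or at `n = rank E(ℚ)`
  (`minimalPackage_of_katoHalf_of_norm_coeff_mordellWeilRank`): `char_Λ X = (g)`, `μ(X) = 0`,
  `λ(X) = n` — the MAIN CONJECTURE at the pair with the analytic generator `u·ϖ·B`.
* §2 (class level, X4(M) ∧ surj, both parities, EVERY odd `p`) from the census record:
  `ClassX4M.isTorsion_and_exists_unitContent_lam_le_of_katoHalf_of_firstUnitIndex[_odd]`, the
  generator form `ClassX4M.mu_zero_and_lam_le_of_katoHalf_of_firstUnitIndex[_odd]` and p01's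
  currency `ClassX4M.charLamLeAt_of_katoHalf_of_firstUnitIndex[_odd]` (`CharLamLeAt W p n₀`).
Sequels: `PotMultKatoFirstUnitIndexClass.lean` (`μ = 0` from p06's weaker binder, `rank ≤ n₀`, the
class-level main conjecture from the budget / on minimal rows) and
`PotMultCongruentPartnerMainConjecture.lean` (K-OUT to the typed LOWER nodes, the congruent-partner
source of the budget, the rank-`0` BSD ends).

What is NOT claimed: the budget bound itself (typed, per curve, outside the kernel); anything on
rows with `n₀ > B(E,p)` and no partner (pure-Ш void rows); non-surjective rows (O8: the image
hypothesis of `hK`); any BSD_p consequence (sequel); `p = 2`. Labels UNCHANGED; nothing booked.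

References: K. Kato, Astérisque 295 (2004) Thm. 17.4 (3) [Kato2004Asterisque]; C. Wuthrich, Doc.
Math. 19 (2014) §3, Lemma 20 [Wuthrich2014]; R. Greenberg, V. Vatsal, Invent. Math. 142 (2000)
p. 4 [GreenbergVatsal2000]; R. Greenberg, LNM 1716 (1999) §1, §3 Lemma 3.1 [GreenbergLNM1716];
M. Emerton, R. Pollack, T. Weston, Invent. Math. 163 (2006) §3 [EmertonPollackWeston2006];
B. Mazur, J. Tate, J. Teitelbaum, Invent. Math. 84 (1986) §I.10, §I.13 [MazurTateTeitelbaum1986Invent];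
L. Washington, GTM 83 (1997) §7.1, §13.2 [Washington1997]; W. Stein, C. Wuthrich, Math. Comp. 82
(2013) §11 remark [SteinWuthrich2013].
-/

set_option autoImplicit false

noncomputable section

open scoped Classical MatrixGroups ModularForm NumberField

namespace Summit.BirchSwinnertonDyer.Rank1Residual.AdditivePotMult

open CongruenceSubgroup WeierstrassCurve NumberField Literature.NumberTheory.EllipticCurves
  Literature.NumberTheory.EllipticCurves.ModularForms
  Literature.NumberTheory.EllipticCurves.Rank1Residual
  Literature.NumberTheory.EllipticCurves.Rank1Residual.Typed
  Literature.NumberTheory.EllipticCurves.GreenbergVatsal2000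
  Literature.NumberTheory.GaloisRepresentations
  Summit.BirchSwinnertonDyer.Rank1Residual.Additive
  Summit.BirchSwinnertonDyer.Rank1Residual.Additive.CensusQ6
  Summit.BirchSwinnertonDyer.Rank1Residual.X1.MuLambda
  Summit.BirchSwinnertonDyer.Rank1Residual.X11a
  Summit.BirchSwinnertonDyer.Rank1Residual.X11a.LambdaNorm
  Summit.BirchSwinnertonDyer.Rank1Residual.Iwasawa
  IsDedekindDomain

open Summit.BirchSwinnertonDyer.Rank1Residual.X1.MuPart (mu_generator_eq_muInvariant)
open Summit.BirchSwinnertonDyer.Rank1Residual.X1.ParitySqueeze (lam_generator_eq_lambdaInvariant)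

/-! ### §1 Data level: the index-`n` reading of the full-series brick, and the squeeze -/

section DataLevel

variable {W : WeierstrassCurve ℚ} [W.IsElliptic] {p : ℕ} [hp : Fact p.Prime]

/-- **Data level, EVERY odd `p`, any semistable twist datum, index `n`.** For a twist model
`C • V^{(p*)} = W` (`p* = (−1)^{⌊p/2⌋} p`) with `ρ̄_{V,pⁿ}` onto for all `n`, a cyclotomic `κ/γ`
matching the cyclotomic variable, the newform `f` of `V`, a branch series `B` in the reduction
disjunction of the fact, the period ratio `ϖ` of the parity of `(p−1)/2`, EVERY `Λ`-dual datum `D`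
of `Sel_{p^∞}(W/ℚ_∞)` and an index `n` with `‖[Tⁿ](ϖ·B)‖_p = 1`: `X(W/ℚ_∞)` is torsion and SOME
`g ∈ char_Λ X(W/ℚ_∞)` has `ι g = C(u·ϖ)·B` (`u ∈ ℤ_p^×`), unit content (`μ(g) = 0`) and `λ(g) ≤ n`.
The brick `isTorsion_and_exists_iota_eq_of_katoHalf` (Kato 17.4 (3) via `hK`) + n1011-p10's K-G.
[cite: Kato2004Asterisque, Thm. 17.4 (3) (p. 273)] [cite: GreenbergVatsal2000, p. 4 ((μ, λ) of a power series)]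
[cite: Washington1997, §7.1] -/
theorem isTorsion_and_exists_iota_eq_unitContent_of_katoHalf
    (hK : Wuthrich2014.kato_halfEigenCharIdeal_dvd_cyclotomicPrime_of_surjective) (hp2 : p ≠ 2)
    (V : WeierstrassCurve ℚ) [V.IsElliptic] [V.IsGloballyMinimal] (C : VariableChange ℚ)
    (hC : C • V.quadraticTwist ((-1 : ℚ) ^ (p / 2) * p) = W)
    (hsurjV : ∀ n : ℕ, V.HasSurjectiveModNGaloisRep (p ^ n : ℕ))
    {κ : ZpExtension ℚ p} {γ : Field.absoluteGaloisGroup ℚ}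
    (hκ : κ.IsCyclotomic) (hγ : κ.IsTopGenerator γ) (hcv : IsCyclotomicVariable p γ)
    {N : ℕ} [NeZero N] {f : CuspForm (Gamma0 N) 2} (hf : IsNewformOf V f)
    (D : W.SelmerDualData κ γ) (B : PowerSeries ℚ_[p])
    (hdisj : (IsOrdinaryAt V p ∧
        B = if Even (p / 2) then padicLFunctionBranch f ((unitRoot V p : ℤ_[p]) : ℚ_[p]) (p / 2)
          else padicLFunctionMinusBranch f ((unitRoot V p : ℤ_[p]) : ℚ_[p]) (p / 2)) ∨
      (V.HasSplitMultiplicativeReductionAtPrime p ∧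
        B = if Even (p / 2) then padicLFunctionPlusBranchMult f (1 : ℚ_[p]) (p / 2)
          else padicLFunctionMinusBranchMult f (1 : ℚ_[p]) (p / 2)) ∨
      (V.HasMultiplicativeReductionAtPrime p ∧ ¬ V.HasSplitMultiplicativeReductionAtPrime p ∧
        B = if Even (p / 2) then padicLFunctionPlusBranchMult f (-1 : ℚ_[p]) (p / 2)
          else padicLFunctionMinusBranchMult f (-1 : ℚ_[p]) (p / 2)))
    (ϖ : ℚ) (hϖ : if Even (p / 2) then (ϖ : ℝ) * V.realPeriodRat = plusPeriod f
      else (ϖ : ℝ) * V.imaginaryPeriodRat = minusPeriod f)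
    {n : ℕ} (hn : ‖PowerSeries.coeff n (PowerSeries.C (ϖ : ℚ_[p]) * B)‖ = 1) :
    D.IsTorsion ∧ ∃ g ∈ D.charIdeal,
      (∃ u : ℤ_[p]ˣ,
        iwasawaToPowerSeries p g = PowerSeries.C (((u : ℤ_[p]) : ℚ_[p]) * (ϖ : ℚ_[p])) * B) ∧
      HasUnitContent g ∧ lam g ≤ n := by
  obtain ⟨hXt, g, hg, u, hι⟩ :=
    isTorsion_and_exists_iota_eq_of_katoHalf hK hp2 V C hC hsurjV hκ hγ hcv hf D B hdisj ϖ hϖ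
  exact ⟨hXt, g, hg, ⟨u, hι⟩, hasUnitContent_and_lam_le_of_iota_eq_of_norm_coeff_eq_one hι hn⟩

omit [W.IsElliptic] hp in
/-- Generator form of the reading: if `g ∈ (fE)` has unit content and `λ(g) ≤ n`, then `fE` has unit
content, `μ(fE) = 0` and `λ(fE) ≤ n` (unit content passes to divisors; `λ` is monotone along
divisibility of non-zero elements). [cite: Washington1997, §7.1] -/
theorem unitContent_and_mu_eq_zero_and_lam_le_of_mem_span [Fact p.Prime] {fE g : IwasawaAlgebra p}
    {n : ℕ} (hg : g ∈ Ideal.span ({fE} : Set (IwasawaAlgebra p))) (hunit : HasUnitContent g)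
    (hlam : lam g ≤ n) : HasUnitContent fE ∧ mu fE = 0 ∧ lam fE ≤ n := by
  obtain ⟨h, rfl⟩ := Ideal.mem_span_singleton.mp hg
  have hfE : HasUnitContent fE := hasUnitContent_left_of_mul hunit
  have hfE0 : fE ≠ 0 := ne_zero_of_hasUnitContent hfE
  have hh0 : h ≠ 0 := by
    rintro rfl
    exact ne_zero_of_hasUnitContent hunit (mul_zero fE)
  exact ⟨hfE, mu_eq_zero_of_hasUnitContent hfE, (lam_le_lam_mul hfE0 hh0).trans hlam⟩

/-- **The MAIN CONJECTURE at the pair from the budget (data level, EVERY odd `p`).** Same binders as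
`isTorsion_and_exists_iota_eq_unitContent_of_katoHalf` at index `b`, plus n1011-p10's typed per-curve
LOWER input `BudgetLeLambdaAt p W b` (`μ(X) = 0 ⟹ b ≤ λ(X)`; per curve: EPW 2006 Cor. 3.2.5 +
Thm. 3.1.1 with `b = B(E,p)` the `p`-Tamagawa budget): for EVERY cyclotomic dual datum `D`,
`X(W/ℚ_∞)` is torsion and `char_Λ X(W/ℚ_∞) = (g)` with `ι g = C(u·ϖ)·B`, `g` of unit content,
`μ(X) = 0`, `λ(X) = b` — i.e. `char_Λ X = (ϖ·B)·Λ^×` in `ℚ_p⟦T⟧`. Route: §1 + a generator `fE`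
(`charIdeal_isPrincipal_holds`) + p10's `budgetSqueeze` (`Iwasawa.span_eq_span_of_dvd_of_lam_le`).
[cite: Kato2004Asterisque, Thm. 17.4 (3) (p. 273)] [cite: EmertonPollackWeston2006, Cor. 3.2.5 and Thm. 3.1.1 (source of the typed input)]
[cite: GreenbergVatsal2000, p. 4 (after Thm. (1.2))] [cite: Washington1997, §13.2] -/
theorem charIdeal_eq_span_of_katoHalf_of_norm_coeff_of_budget [W.IsGloballyMinimal]
    (hK : Wuthrich2014.kato_halfEigenCharIdeal_dvd_cyclotomicPrime_of_surjective) (hp2 : p ≠ 2)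
    {b : ℕ} (hbud : BudgetLeLambdaAt p W b)
    (V : WeierstrassCurve ℚ) [V.IsElliptic] [V.IsGloballyMinimal] (C : VariableChange ℚ)
    (hC : C • V.quadraticTwist ((-1 : ℚ) ^ (p / 2) * p) = W)
    (hsurjV : ∀ n : ℕ, V.HasSurjectiveModNGaloisRep (p ^ n : ℕ))
    {κ : ZpExtension ℚ p} {γ : Field.absoluteGaloisGroup ℚ}
    (hκ : κ.IsCyclotomic) (hγ : κ.IsTopGenerator γ) (hcv : IsCyclotomicVariable p γ)
    {N : ℕ} [NeZero N] {f : CuspForm (Gamma0 N) 2} (hf : IsNewformOf V f)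
    (D : W.SelmerDualData κ γ) (B : PowerSeries ℚ_[p])
    (hdisj : (IsOrdinaryAt V p ∧
        B = if Even (p / 2) then padicLFunctionBranch f ((unitRoot V p : ℤ_[p]) : ℚ_[p]) (p / 2)
          else padicLFunctionMinusBranch f ((unitRoot V p : ℤ_[p]) : ℚ_[p]) (p / 2)) ∨
      (V.HasSplitMultiplicativeReductionAtPrime p ∧
        B = if Even (p / 2) then padicLFunctionPlusBranchMult f (1 : ℚ_[p]) (p / 2)
          else padicLFunctionMinusBranchMult f (1 : ℚ_[p]) (p / 2)) ∨
      (V.HasMultiplicativeReductionAtPrime p ∧ ¬ V.HasSplitMultiplicativeReductionAtPrime p ∧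
        B = if Even (p / 2) then padicLFunctionPlusBranchMult f (-1 : ℚ_[p]) (p / 2)
          else padicLFunctionMinusBranchMult f (-1 : ℚ_[p]) (p / 2)))
    (ϖ : ℚ) (hϖ : if Even (p / 2) then (ϖ : ℝ) * V.realPeriodRat = plusPeriod f
      else (ϖ : ℝ) * V.imaginaryPeriodRat = minusPeriod f)
    (hn : ‖PowerSeries.coeff b (PowerSeries.C (ϖ : ℚ_[p]) * B)‖ = 1) :
    D.IsTorsion ∧ ∃ g : IwasawaAlgebra p, D.charIdeal = Ideal.span {g} ∧
      (∃ u : ℤ_[p]ˣ,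
        iwasawaToPowerSeries p g = PowerSeries.C (((u : ℤ_[p]) : ℚ_[p]) * (ϖ : ℚ_[p])) * B) ∧
      HasUnitContent g ∧ D.mu = 0 ∧ lambdaInvariant p D.X = b := by
  obtain ⟨hXt, g, hg, hu, hunit, hlam⟩ := isTorsion_and_exists_iota_eq_unitContent_of_katoHalf hK hp2
    V C hC hsurjV hκ hγ hcv hf D B hdisj ϖ hϖ hn
  haveI : Module.Finite (IwasawaAlgebra p) D.X := D.module_finite_holds hγ
  obtain ⟨fE, hchar⟩ := (charIdeal_isPrincipal_holds p D.X).principal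
  have hchar' : D.charIdeal = Ideal.span {fE} := hchar
  have hdvd : fE ∣ g := Ideal.mem_span_singleton.mp (hchar' ▸ hg)
  obtain ⟨hspan, hmu, hlamD⟩ := budgetSqueeze p W hbud hκ hγ hcv D hXt hchar' hunit hdvd hlam
  exact ⟨hXt, g, hchar'.trans hspan.symm, hu, hunit, hmu, hlamD⟩

/-- **MINIMAL PAIRS: the main conjecture at the pair with NO lower input (data level, EVERY odd `p`).**
Same binders at index `n = rank W(ℚ)`: `T^{rank} ∣ fE` (`Typed.X_pow_mordellWeilRank_dvd_of_charIdeal_eq_span`)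
and iw-1's `Iwasawa.minimal_package` give, for EVERY generator `fE` of `char_Λ X(W/ℚ_∞)`:
`(g) = (fE)` with `ι g = C(u·ϖ)·B`, `λ(fE) = λ(g) = rank W(ℚ)`, `μ(fE) = μ(g) = 0`,
`ord_{T=0} fE = rank W(ℚ)` and `[T^{rank}] fE ∈ ℤ_p^×`. (T-O7KM's rank-one certificate rows are the
case `rank = 1`; unit rows the case `rank = 0`.) [cite: Kato2004Asterisque, Thm. 17.4 (3) (p. 273)]
[cite: GreenbergLNM1716, §3 Lemma 3.1 (T^{rank} ∣ char)] [cite: SteinWuthrich2013, §11 remark (p. 29)]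
[cite: GreenbergVatsal2000, p. 4 (after Thm. (1.2))] -/
theorem minimalPackage_of_katoHalf_of_norm_coeff_mordellWeilRank
    (hK : Wuthrich2014.kato_halfEigenCharIdeal_dvd_cyclotomicPrime_of_surjective) (hp2 : p ≠ 2)
    (V : WeierstrassCurve ℚ) [V.IsElliptic] [V.IsGloballyMinimal] (C : VariableChange ℚ)
    (hC : C • V.quadraticTwist ((-1 : ℚ) ^ (p / 2) * p) = W)
    (hsurjV : ∀ n : ℕ, V.HasSurjectiveModNGaloisRep (p ^ n : ℕ))
    {κ : ZpExtension ℚ p} {γ : Field.absoluteGaloisGroup ℚ}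
    (hκ : κ.IsCyclotomic) (hγ : κ.IsTopGenerator γ) (hcv : IsCyclotomicVariable p γ)
    {N : ℕ} [NeZero N] {f : CuspForm (Gamma0 N) 2} (hf : IsNewformOf V f)
    (D : W.SelmerDualData κ γ) (B : PowerSeries ℚ_[p])
    (hdisj : (IsOrdinaryAt V p ∧
        B = if Even (p / 2) then padicLFunctionBranch f ((unitRoot V p : ℤ_[p]) : ℚ_[p]) (p / 2)
          else padicLFunctionMinusBranch f ((unitRoot V p : ℤ_[p]) : ℚ_[p]) (p / 2)) ∨
      (V.HasSplitMultiplicativeReductionAtPrime p ∧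
        B = if Even (p / 2) then padicLFunctionPlusBranchMult f (1 : ℚ_[p]) (p / 2)
          else padicLFunctionMinusBranchMult f (1 : ℚ_[p]) (p / 2)) ∨
      (V.HasMultiplicativeReductionAtPrime p ∧ ¬ V.HasSplitMultiplicativeReductionAtPrime p ∧
        B = if Even (p / 2) then padicLFunctionPlusBranchMult f (-1 : ℚ_[p]) (p / 2)
          else padicLFunctionMinusBranchMult f (-1 : ℚ_[p]) (p / 2)))
    (ϖ : ℚ) (hϖ : if Even (p / 2) then (ϖ : ℝ) * V.realPeriodRat = plusPeriod f
      else (ϖ : ℝ) * V.imaginaryPeriodRat = minusPeriod f)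
    (hn : ‖PowerSeries.coeff W.mordellWeilRank (PowerSeries.C (ϖ : ℚ_[p]) * B)‖ = 1)
    {fE : IwasawaAlgebra p} (hchar : D.charIdeal = Ideal.span {fE}) :
    D.IsTorsion ∧ ∃ g : IwasawaAlgebra p,
      (∃ u : ℤ_[p]ˣ,
        iwasawaToPowerSeries p g = PowerSeries.C (((u : ℤ_[p]) : ℚ_[p]) * (ϖ : ℚ_[p])) * B) ∧
      Ideal.span ({g} : Set (IwasawaAlgebra p)) = Ideal.span {fE} ∧ lam fE = W.mordellWeilRank ∧
      lam g = W.mordellWeilRank ∧ mu fE = 0 ∧ mu g = 0 ∧ fE.order = W.mordellWeilRank ∧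
      IsUnit (PowerSeries.coeff W.mordellWeilRank fE) := by
  obtain ⟨hXt, g, hg, hu, hunit, hlam⟩ := isTorsion_and_exists_iota_eq_unitContent_of_katoHalf hK hp2
    V C hC hsurjV hκ hγ hcv hf D B hdisj ϖ hϖ hn
  haveI : Module.Finite (IwasawaAlgebra p) D.X := D.module_finite_holds hγ
  have hdvd : fE ∣ g := Ideal.mem_span_singleton.mp (hchar ▸ hg)
  have hXr : (PowerSeries.X : IwasawaAlgebra p) ^ W.mordellWeilRank ∣ fE :=
    X_pow_mordellWeilRank_dvd_of_charIdeal_eq_span W p hγ D hXt hchar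
  exact ⟨hXt, g, hu, minimal_package hunit hdvd hXr hlam⟩

end DataLevel

/-! ### §2 Class level on X4(M) ∩ {`ρ̄_{E,p}` onto}: the census record discharges `μ = 0 ∧ λ ≤ n₀` -/

section ClassLevel

variable {W : WeierstrassCurve ℚ} [W.IsElliptic] {p : ℕ} [hp : Fact p.Prime]

/-- **X4(M) ∩ {`ρ̄_{E,p}` onto}, `p ≡ 1 (mod 4)` (even branch): Kato's divisibility + the census
record `MultFirstUnitIndexAt W p n₀` ⟹ for EVERY cyclotomic dual datum: `X(E/ℚ_∞)` is torsion and
SOME `g ∈ char_Λ X(E/ℚ_∞)` has unit content and `λ(g) ≤ n₀`.** Inputs: `hK`, `hmodD`, the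
multiplicative twist model (`ClassX4M.exists_mult_pStar_twist_model`), `a_p(E♭) = ±1`
(`IsNewformOf.cuspCoeff_eq_one_and_sq_of_split` / `…_neg_one_and_dvd_of_nonsplit`), the tower of
`E♭` from surj(p) of `E` (`PotMult.towerSurj_twist_of_surj`, no `hL20`, `p = 3` would be odd), §1.
Only the UNIT clause of the record is used. [cite: Kato2004Asterisque, Thm. 17.4 (3) (p. 273)]
[cite: Wuthrich2014, Lemma 20 (p. 399)] [cite: MazurTateTeitelbaum1986Invent, §I.13 (the branch series)] -/
theorem ClassX4M.isTorsion_and_exists_unitContent_lam_le_of_katoHalf_of_firstUnitIndex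
    (hK : Wuthrich2014.kato_halfEigenCharIdeal_dvd_cyclotomicPrime_of_surjective)
    (hmodD : nonempty_modularParametrizationData)
    (hX : ClassX4M W p) (hsurj : Surj W p) (hp4 : p % 4 = 1) {n₀ : ℕ}
    (hrec : MultFirstUnitIndexAt W p n₀)
    {κ : ZpExtension ℚ p} {γ : Field.absoluteGaloisGroup ℚ}
    (hκ : κ.IsCyclotomic) (hγ : κ.IsTopGenerator γ) (hγ' : IsCyclotomicVariable p γ)
    (D : W.SelmerDualData κ γ) :
    D.IsTorsion ∧ ∃ g ∈ D.charIdeal, HasUnitContent g ∧ lam g ≤ n₀ := by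
  have hp2 : p ≠ 2 := hX.p_ne_two
  obtain ⟨V, iV, iVm, C, hV, hC⟩ := hX.exists_mult_pStar_twist_model
  haveI : NeZero (V.conductorNorm ℤ) := ⟨(V.conductorNorm_pos_holds).ne'⟩
  obtain ⟨Dm⟩ := hmodD V
  obtain ⟨ϖ, hϖ⟩ := exists_periodRatio_parity (p := p) V Dm
  have hsurjV : ∀ n : ℕ, V.HasSurjectiveModNGaloisRep (p ^ n : ℕ) :=
    (ClassX4M.potMult W p hX).towerSurj_twist_of_surj hp2 hsurj V C hC
  have heven : Even (p / 2) := ⟨p / 4, by omega⟩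
  have hC' : C • V.quadraticTwist (p : ℚ) = W := by
    rw [← pStar_eq_self_of_mod_four_eq_one hp4]; exact hC
  have hϖ' : (ϖ : ℝ) * V.realPeriodRat = plusPeriod Dm.f := by
    rw [if_pos heven] at hϖ; exact hϖ
  by_cases hs : V.HasSplitMultiplicativeReductionAtPrime p
  · obtain ⟨hap, -⟩ := Dm.isNewformOf.cuspCoeff_eq_one_and_sq_of_split hs
    have hn := (hrec V C hV hC' Dm.f Dm.isNewformOf 1 (by exact_mod_cast hap) ϖ hϖ').2
    rw [Int.cast_one] at hn
    obtain ⟨hXt, g, hg, -, hunit, hlam⟩ := isTorsion_and_exists_iota_eq_unitContent_of_katoHalf hK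
      hp2 V C hC hsurjV hκ hγ hγ' Dm.isNewformOf D _ (Or.inr (Or.inl ⟨hs, rfl⟩)) ϖ hϖ
      (n := n₀) (by rw [if_pos heven]; exact hn)
    exact ⟨hXt, g, hg, hunit, hlam⟩
  · obtain ⟨hap, -⟩ := Dm.isNewformOf.cuspCoeff_eq_neg_one_and_dvd_of_nonsplit hV hs
    have hn := (hrec V C hV hC' Dm.f Dm.isNewformOf (-1) (by exact_mod_cast hap) ϖ hϖ').2
    rw [Int.cast_neg, Int.cast_one] at hn
    obtain ⟨hXt, g, hg, -, hunit, hlam⟩ := isTorsion_and_exists_iota_eq_unitContent_of_katoHalf hK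
      hp2 V C hC hsurjV hκ hγ hγ' Dm.isNewformOf D _ (Or.inr (Or.inr ⟨hV, hs, rfl⟩)) ϖ hϖ
      (n := n₀) (by rw [if_pos heven]; exact hn)
    exact ⟨hXt, g, hg, hunit, hlam⟩

/-- **X4(M) ∩ {`ρ̄_{E,p}` onto}, `p ≡ 3 (mod 4)` (`p = 3` included; odd branch, twist by `−p`, minus
period): Kato's divisibility + the record `MultOddFirstUnitIndexAt W p n₀` ⟹ for EVERY cyclotomic dual
datum: `X(E/ℚ_∞)` is torsion and SOME `g ∈ char_Λ X(E/ℚ_∞)` has unit content and `λ(g) ≤ n₀`.**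
[cite: Kato2004Asterisque, Thm. 17.4 (3) (p. 273)] [cite: Wuthrich2014, Lemma 20 (p. 399)]
[cite: MazurTateTeitelbaum1986Invent, §I.13 (the branch series)] -/
theorem ClassX4M.isTorsion_and_exists_unitContent_lam_le_of_katoHalf_of_firstUnitIndex_odd
    (hK : Wuthrich2014.kato_halfEigenCharIdeal_dvd_cyclotomicPrime_of_surjective)
    (hmodD : nonempty_modularParametrizationData)
    (hX : ClassX4M W p) (hsurj : Surj W p) (hp4 : p % 4 = 3) {n₀ : ℕ}
    (hrec : MultOddFirstUnitIndexAt W p n₀)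
    {κ : ZpExtension ℚ p} {γ : Field.absoluteGaloisGroup ℚ}
    (hκ : κ.IsCyclotomic) (hγ : κ.IsTopGenerator γ) (hγ' : IsCyclotomicVariable p γ)
    (D : W.SelmerDualData κ γ) :
    D.IsTorsion ∧ ∃ g ∈ D.charIdeal, HasUnitContent g ∧ lam g ≤ n₀ := by
  have hp2 : p ≠ 2 := hX.p_ne_two
  obtain ⟨V, iV, iVm, C, hV, hC⟩ := hX.exists_mult_pStar_twist_model
  haveI : NeZero (V.conductorNorm ℤ) := ⟨(V.conductorNorm_pos_holds).ne'⟩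
  obtain ⟨Dm⟩ := hmodD V
  obtain ⟨ϖ, hϖ⟩ := exists_periodRatio_parity (p := p) V Dm
  have hsurjV : ∀ n : ℕ, V.HasSurjectiveModNGaloisRep (p ^ n : ℕ) :=
    (ClassX4M.potMult W p hX).towerSurj_twist_of_surj hp2 hsurj V C hC
  have hodd : ¬ Even (p / 2) := by rw [Nat.not_even_iff_odd]; exact ⟨p / 4, by omega⟩
  have hC' : C • V.quadraticTwist (-(p : ℚ)) = W := by
    rw [← pStar_eq_neg_of_mod_four_eq_three hp4]; exact hC
  have hϖ' : (ϖ : ℝ) * V.imaginaryPeriodRat = minusPeriod Dm.f := by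
    rw [if_neg hodd] at hϖ; exact hϖ
  by_cases hs : V.HasSplitMultiplicativeReductionAtPrime p
  · obtain ⟨hap, -⟩ := Dm.isNewformOf.cuspCoeff_eq_one_and_sq_of_split hs
    have hn := (hrec V C hV hC' Dm.f Dm.isNewformOf 1 (by exact_mod_cast hap) ϖ hϖ').2
    rw [Int.cast_one] at hn
    obtain ⟨hXt, g, hg, -, hunit, hlam⟩ := isTorsion_and_exists_iota_eq_unitContent_of_katoHalf hK
      hp2 V C hC hsurjV hκ hγ hγ' Dm.isNewformOf D _ (Or.inr (Or.inl ⟨hs, rfl⟩)) ϖ hϖ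
      (n := n₀) (by rw [if_neg hodd]; exact hn)
    exact ⟨hXt, g, hg, hunit, hlam⟩
  · obtain ⟨hap, -⟩ := Dm.isNewformOf.cuspCoeff_eq_neg_one_and_dvd_of_nonsplit hV hs
    have hn := (hrec V C hV hC' Dm.f Dm.isNewformOf (-1) (by exact_mod_cast hap) ϖ hϖ').2
    rw [Int.cast_neg, Int.cast_one] at hn
    obtain ⟨hXt, g, hg, -, hunit, hlam⟩ := isTorsion_and_exists_iota_eq_unitContent_of_katoHalf hK
      hp2 V C hC hsurjV hκ hγ hγ' Dm.isNewformOf D _ (Or.inr (Or.inr ⟨hV, hs, rfl⟩)) ϖ hϖ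
      (n := n₀) (by rw [if_neg hodd]; exact hn)
    exact ⟨hXt, g, hg, hunit, hlam⟩

/-- **Generator form, `p ≡ 1 (mod 4)`: for EVERY generator `fE` of `char_Λ X(E/ℚ_∞)`, `X` is torsion,
`μ(fE) = 0` and `λ(fE) ≤ n₀`** — the index-`n₀` generalisation of T-O7KM's
`ClassX4M.isTorsion_and_mu_zero_lam_le_one_of_katoHalf_of_multCert`. [cite: Kato2004Asterisque, Thm. 17.4 (3) (p. 273)]
[cite: Washington1997, §7.1] -/
theorem ClassX4M.mu_zero_and_lam_le_of_katoHalf_of_firstUnitIndex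
    (hK : Wuthrich2014.kato_halfEigenCharIdeal_dvd_cyclotomicPrime_of_surjective)
    (hmodD : nonempty_modularParametrizationData)
    (hX : ClassX4M W p) (hsurj : Surj W p) (hp4 : p % 4 = 1) {n₀ : ℕ}
    (hrec : MultFirstUnitIndexAt W p n₀)
    {κ : ZpExtension ℚ p} {γ : Field.absoluteGaloisGroup ℚ}
    (hκ : κ.IsCyclotomic) (hγ : κ.IsTopGenerator γ) (hγ' : IsCyclotomicVariable p γ)
    (D : W.SelmerDualData κ γ) {fE : IwasawaAlgebra p} (hchar : D.charIdeal = Ideal.span {fE}) :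
    D.IsTorsion ∧ HasUnitContent fE ∧ mu fE = 0 ∧ lam fE ≤ n₀ := by
  obtain ⟨hXt, g, hg, hunit, hlam⟩ :=
    hX.isTorsion_and_exists_unitContent_lam_le_of_katoHalf_of_firstUnitIndex hK hmodD hsurj hp4 hrec hκ
      hγ hγ' D
  exact ⟨hXt, unitContent_and_mu_eq_zero_and_lam_le_of_mem_span (hchar ▸ hg) hunit hlam⟩

/-- **Generator form, `p ≡ 3 (mod 4)` (`p = 3` included).** [cite: Kato2004Asterisque, Thm. 17.4 (3) (p. 273)]
[cite: Washington1997, §7.1] -/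
theorem ClassX4M.mu_zero_and_lam_le_of_katoHalf_of_firstUnitIndex_odd
    (hK : Wuthrich2014.kato_halfEigenCharIdeal_dvd_cyclotomicPrime_of_surjective)
    (hmodD : nonempty_modularParametrizationData)
    (hX : ClassX4M W p) (hsurj : Surj W p) (hp4 : p % 4 = 3) {n₀ : ℕ}
    (hrec : MultOddFirstUnitIndexAt W p n₀)
    {κ : ZpExtension ℚ p} {γ : Field.absoluteGaloisGroup ℚ}
    (hκ : κ.IsCyclotomic) (hγ : κ.IsTopGenerator γ) (hγ' : IsCyclotomicVariable p γ)
    (D : W.SelmerDualData κ γ) {fE : IwasawaAlgebra p} (hchar : D.charIdeal = Ideal.span {fE}) :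
    D.IsTorsion ∧ HasUnitContent fE ∧ mu fE = 0 ∧ lam fE ≤ n₀ := by
  obtain ⟨hXt, g, hg, hunit, hlam⟩ :=
    hX.isTorsion_and_exists_unitContent_lam_le_of_katoHalf_of_firstUnitIndex_odd hK hmodD hsurj hp4 hrec
      hκ hγ hγ' D
  exact ⟨hXt, unitContent_and_mu_eq_zero_and_lam_le_of_mem_span (hchar ▸ hg) hunit hlam⟩

/-- **n1011-p01's typed λ-input `CharLamLeAt W p n₀` HOLDS on X4(M) ∩ {`ρ̄` onto}, `p ≡ 1 (mod 4)`,
given the record** (T-O7KM's `charLamLeAt_one_…` is the case `n₀ = 1`).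
[cite: Kato2004Asterisque, Thm. 17.4 (3) (p. 273)] -/
theorem ClassX4M.charLamLeAt_of_katoHalf_of_firstUnitIndex
    (hK : Wuthrich2014.kato_halfEigenCharIdeal_dvd_cyclotomicPrime_of_surjective)
    (hmodD : nonempty_modularParametrizationData)
    (hX : ClassX4M W p) (hsurj : Surj W p) (hp4 : p % 4 = 1) {n₀ : ℕ}
    (hrec : MultFirstUnitIndexAt W p n₀) : CharLamLeAt W p n₀ :=
  fun _ _ hκ hγ hγ' D _ hchar ↦
    (hX.mu_zero_and_lam_le_of_katoHalf_of_firstUnitIndex hK hmodD hsurj hp4 hrec hκ hγ hγ' D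
      hchar).2.2.2

/-- **`CharLamLeAt W p n₀` on X4(M) ∩ {`ρ̄` onto}, `p ≡ 3 (mod 4)` (`p = 3` included), given the
record.** [cite: Kato2004Asterisque, Thm. 17.4 (3) (p. 273)] -/
theorem ClassX4M.charLamLeAt_of_katoHalf_of_firstUnitIndex_odd
    (hK : Wuthrich2014.kato_halfEigenCharIdeal_dvd_cyclotomicPrime_of_surjective)
    (hmodD : nonempty_modularParametrizationData)
    (hX : ClassX4M W p) (hsurj : Surj W p) (hp4 : p % 4 = 3) {n₀ : ℕ}
    (hrec : MultOddFirstUnitIndexAt W p n₀) : CharLamLeAt W p n₀ :=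
  fun _ _ hκ hγ hγ' D _ hchar ↦
    (hX.mu_zero_and_lam_le_of_katoHalf_of_firstUnitIndex_odd hK hmodD hsurj hp4 hrec hκ hγ hγ' D
      hchar).2.2.2

end ClassLevel

end Summit.BirchSwinnertonDyer.Rank1Residual.AdditivePotMult

end
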